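import Summits.BirchSwinnertonDyer.BirchSwinnertonDyer.Theorems.EisensteinPrimesBSDpOnCellCLogSymmetry
import Summits.BirchSwinnertonDyer.Rank1Residual.X2.IMCEqOnTreeIntOther
import Summits.BirchSwinnertonDyer.Rank1Residual.X2.NonsplitCellCClassInt
import Summits.BirchSwinnertonDyer.Rank1Residual.X2.SplitCellCClassInt
import Summits.BirchSwinnertonDyer.BirchSwinnertonDyer.Theorems.EisensteinPrimesBSDpOnCellCCtlSplitClass
import HarnessLib

/-!
# Crux 4 `BSDpOnCellC` (stmt-BirchSwinnertonDyer-19034), line b1: the b1 roads RE-THREADED on the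
# RE-ORIENTED IMC atoms c3♭′ / c3s♭′ (`X2.NonsplitIMCEqOnTreeIntOther`, `X2.SplitIMCEqOnTreeIntOther`;
# X-slot at `𝔭̄`, frames at `(ι′, 𝔭)` — RULING L31 (R1)) — PART 1: DATUM LEVEL, BOTH signs
# (cell `bsd-eis`, seat `bsd-eis-cgshw` g12; part 2 = `…ReorientedPointwise.lean`)

HONEST FRAMING (cell `bsd-eis`, run/shared/lean/pub/bsd-eis/): theorems only; nothing booked; X2 stays
CONSTRUCTION-SHAPED; no label or count moves; BSD is not proved by any of this. Every theorem is
CONDITIONAL on its displayed binders — in particular on the value atom c2♭ / c2s♭ (NOT in print at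
`3 ‖ N`) and the re-oriented IMC atom c3♭′ / c3s♭′ (Keller–Yin Thm. D shape, PREPRINT with the L1754 gap).

## What is re-threaded, and the one new step

The tree's b1 roads `X2.bsdp_of_cellC_of_not_split_of_hsieh2014_of_intHalvesOnTree_of_partner` (k5-c4,
`X2/NonsplitHalvesOnTreeInt.lean`), `X2.bsdp_of_cellC_of_split_of_hsieh2014_of_intHalvesOnTree_of_partner`
(cgshw g8, `X2/SplitHalvesOnTreeInt.lean`) and their pointwise-with-Manin-datum consumers
`X2.bsdp_of_cellC_of_not_split_of_manin_of_intResiduals(_of_partner)` /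
`X2.bsdp_of_cellC_of_split_of_manin_of_intResiduals` instantiate the IMC atom at the frame's own prime
`𝔭`. Here the SAME proofs run with the IMC atom read at the OTHER prime `𝔭̄` (produced by
`X11b.LocalIndexTransport.exists_conj_prime_of_splitsIn`, degree one by `X11b.degreeOne_of_splitsIn`): the
two ♭ atoms at Hsieh's frame `Q` at `(ι′, 𝔭)` give (IMC∘BDP)@`𝟙` at `(𝔭̄, embAt K p 𝔭̄)` by
`Theorems.LogSymmetry.imcWaldspurgerOnTreeAt_other_of_intHalves_of_not_split_of_rankOne` /
`…_of_splitControl` (control theorem at `𝔭̄`; `ord_p log_𝔭 P = ord_p log_𝔭̄ P` in rank one), and the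
UNCHANGED shadow-link consumers (`X2.bsdp_of_cellC_of_not_split_of_imcWaldspurgerOnTree_of_partner`,
`X11b.exists_shadowLinks_of_onTree_of_heegner` + `X2.bsdp_of_cellC_of_indexIdentityAt`) conclude at `𝔭̄`.
The only new binder is `Odd (discr K)` (Keller–Yin §0.1), which the Manin-level theorems already HAVE
(`exists_admissibleField_of_rootNumber_eq_neg_one`: `d_K ≡ 1 (mod 8)` by Hoffstein–Luo).

* §1 datum level: `bsdp_of_cellC_of_not_split_of_hsieh2014_of_intHalvesOther_of_partner`,
  `bsdp_of_cellC_of_split_of_hsieh2014_of_intHalvesOther_of_partner`.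
* §2 pointwise with a Manin datum prime to `p` (the field PRODUCED): non-split `…_of_partner` form and the
  parity-cases form (`hMCB` = Mazur's MC on X2b ∩ {non-split}); split parity-cases form with CTL-split
  the THEOREM `Theorems.CtlLoc.splitControlOnTree_of_cellC` (k5-c4 g5, p484252) — no «CTL ∨ switch».

References: [Castella2018] Thm. 2.3, Thm. 3.2, §5 (arXiv:1704.06608 pp. 5, 9, 12); [CastellaEtAl2021]
Thm. 5.3.1 and (5.5)–(5.7); [Hsieh2014] Thm. 1; [KellerYin2024] Thm. D (PRE); [GrossZagier1986] I.(6.3);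
[Mazur1978] Cor. 4.1; [Miller2011LMS] Def. 1.1; RULINGS L29 / L31; cell memos c3h MEMO-2, cgshw MEMO-14.
-/

set_option autoImplicit false
set_option linter.dupNamespace false

noncomputable section

open scoped Classical MatrixGroups ModularForm

open CongruenceSubgroup WeierstrassCurve NumberField IsDedekindDomain Field PowerSeries
  Literature.NumberTheory.EllipticCurves Literature.NumberTheory.EllipticCurves.GreenbergSelmer
  Literature.NumberTheory.EllipticCurves.ModularForms Literature.NumberTheory.QuadraticFields
  Literature.NumberTheory.EllipticCurves.Rank1Residual
  Literature.NumberTheory.EllipticCurves.Rank1Residual.Typed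
  Literature.NumberTheory.EllipticCurves.KrizLi2019
  Literature.NumberTheory.EllipticCurves.GreenbergVatsal2000
  Literature.NumberTheory.EllipticCurves.Wuthrich2014
  Literature.NumberTheory.EllipticCurves.SteinWuthrich2013
  Literature.NumberTheory.GaloisRepresentations Literature.NumberTheory.GaloisCohomology
  Literature.NumberTheory.Automorphic
  Summit.BirchSwinnertonDyer.Rank1Residual.X11b.AcSelmer
  Summit.BirchSwinnertonDyer.Rank1Residual.X11b.Halves
  Summit.BirchSwinnertonDyer.Rank1Residual.X11b
  Summit.BirchSwinnertonDyer.Rank1Residual.X2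
  Summit.BirchSwinnertonDyer.Rank1Residual

namespace Summit.BirchSwinnertonDyer.BirchSwinnertonDyer.Theorems.Reoriented

/-! ### §1 Datum level: Hsieh's frame at `(ι′, 𝔭)`, the IMC atom at `𝔭̄`, conclusion by the shadow links at `𝔭̄` -/

section Datum

variable (W : WeierstrassCurve ℚ) [W.IsElliptic] [W.IsGloballyMinimal] (p : ℕ) [Fact p.Prime]

/-- **Either parity, NON-SPLIT: `BSD(E,p)` at a Heegner datum FROM Hsieh 2014 Thm. 1 + c2♭ + c3♭′ + the
partner's rank-zero `p`-part** — `X2.bsdp_of_cellC_of_not_split_of_hsieh2014_of_intHalvesOnTree_of_partner`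
with the IMC atom RE-ORIENTED (`h3 : X2.NonsplitIMCEqOnTreeIntOther W p`, X-slot at the other prime `𝔭̄`)
and the extra binder `hodd : Odd (discr K)`. Proof: `𝔭̄` from `X11b.LocalIndexTransport.exists_conj_prime_of_splitsIn`
(degree one by `X11b.degreeOne_of_splitsIn`); `ι′` inducing `𝔭` and Hsieh's ♭-frame `Q` there
(`X2.exists_isBDPLFunctionInt_of_hsieh2014_of_classX2`); c2♭ / c3♭′ at `Q`; (IMC∘BDP)@`𝟙` at
`(𝔭̄, embAt K p 𝔭̄)` by `LogSymmetry.imcWaldspurgerOnTreeAt_other_of_intHalves_of_not_split_of_rankOne`;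
then `X2.bsdp_of_cellC_of_not_split_of_imcWaldspurgerOnTree_of_partner` AT `𝔭̄`. CONDITIONAL on every
listed binder; nothing booked. [cite: Hsieh2014, Thm. 1 (arXiv:1112.1580 pp. 3–4)]
[claim: KellerYin2024, status: under-review] [cite: Castella2018, Thm. 2.3, Thm. 3.2 and §5 (arXiv:1704.06608 pp. 5, 9, 12)]
[cite: CastellaEtAl2021, Thm. 5.3.1] [cite: Miller2011LMS, Def. 1.1] -/
theorem bsdp_of_cellC_of_not_split_of_hsieh2014_of_intHalvesOther_of_partner
    (hnf : exists_isNewformOf)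
    (hPT : ∀ (K : Type) [Field K] [NumberField K], poitouTate_selmerStructure_duality K)
    (hPT2 : ∀ (K : Type) [Field K] [NumberField K], poitouTate_sha_tateDual K)
    (hEP : ∀ (K : Type) [Field K] [NumberField K] (v : HeightOneSpectrum (𝓞 K)),
      localEulerPoincareCharacteristic (v.adicCompletion K))
    (hcd : fieldCdLE_two_of_numberField)
    (hBr : ∀ (K : Type) [Field K] [NumberField K] (p : ℕ) [Fact p.Prime],
      ZpExtension.decomp_not_le_kerSubgroup_of_isAnticyclotomic K p)
    (hH : hsieh2014_exists_anticyclotomicPAdicLFunction)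
    (N : ℕ) [NeZero N] (K : Type) [Field K] [NumberField K]
    (Dt : ModularParametrizationData W N) (H : HeegnerDatum N (NumberField.discr K)) (ι : K →+* ℂ)
    (P : (W.baseChange K).toAffine.Point)
    (hGZ : gross_zagier N W K) (hKo : kolyvagin N W K)
    (hGZK : rank_eq_analyticRank_of_analyticRank_le_one)
    (hc : CellC W p) (hns : ¬ W.HasSplitMultiplicativeReductionAtPrime p) (hN : W.conductorNorm ℤ = N)
    (hK : IsImaginaryQuadratic K) (hd4 : NumberField.discr K < -4) (hodd : Odd (NumberField.discr K))
    (hHN : SatisfiesHeegnerHypothesis N K) (hsplit : SatisfiesHeegnerHypothesis p K)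
    (hP : WeierstrassCurve.Affine.Point.map ι.toRatAlgHom P = heegnerPointComplex Dt H)
    (hPinf : ¬ IsOfFinAddOrder P) (hcM : ¬ (p : ℤ) ∣ Dt.c)
    (hLt : (W.quadraticTwist (NumberField.discr K : ℚ)).entireLFunction 1 ≠ 0)
    (Wd : WeierstrassCurve ℚ) [Wd.IsElliptic] [Wd.IsGloballyMinimal] (Cd : VariableChange ℚ)
    (hWd : Cd • W.quadraticTwist (NumberField.discr K : ℚ) = Wd) (htw : PPartRankZero Wd p)
    (htam : padicValNat p Wd.tamagawaProduct = padicValNat p W.tamagawaProduct)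
    (hu : padicValRat p (Cd.u : ℚ) = 0)
    (htamK : padicValNat p (W.baseChange K).tamagawaProduct = 2 * padicValNat p W.tamagawaProduct)
    (κ : ZpExtension K p) (hκ : κ.IsAnticyclotomic) (γ : Field.absoluteGaloisGroup K)
    [Fact (κ.IsTopGenerator γ)] (𝔭 : HeightOneSpectrum (𝓞 K))
    (h𝔭 : ((p : ℕ) : 𝓞 K) ∈ 𝔭.asIdeal) (he : 𝔭.asIdeal.ramificationIdx (𝓞 ℚ) = 1)
    (hf : 𝔭.asIdeal.inertiaDeg (𝓞 ℚ) = 1)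
    (h2 : NonsplitBDPValueOnTreeInt W p) (h3 : NonsplitIMCEqOnTreeIntOther W p) : BSDp W p := by
  subst hN
  have hp : p.Prime := Fact.out
  have hsp : SplitsIn K p := hsplit p hp dvd_rfl
  obtain ⟨f, hfW⟩ := hnf W
  -- the other prime above `p`, of degree one
  obtain ⟨-, 𝔭bar, -, hne, h𝔭bar, -⟩ := LocalIndexTransport.exists_conj_prime_of_splitsIn K p hK.1 hsp h𝔭
  obtain ⟨hebar, hfbar⟩ := degreeOne_of_splitsIn hK.1 hsp h𝔭bar
  -- an embedding datum inducing `𝔭` and Hsieh's ♭-frame there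
  obtain ⟨ι₀⟩ := PadicAlgCl.nonempty_ringEquiv_complex p
  obtain ⟨ι', -, hι'⟩ := X11b.exists_datum_forall_mem_iff p ι₀ hK h𝔭
  obtain ⟨ΩK, Ωp, Q, hΩK, hΩp, hQ⟩ := exists_isBDPLFunctionInt_of_hsieh2014_of_classX2 W p hH ι' 𝔭 κ
    γ hfW hc.2 rfl hK hHN h𝔭 hι' hκ Fact.out
  -- the two ♭ atoms at `Q`: value with the logarithm at `𝔭`, IMC with the X-slot at `𝔭̄`
  have h2Q := h2 (W.conductorNorm ℤ) K Dt H ι P hc hns rfl hK hd4 hHN hLt hP hcM hPinf κ hκ γ 𝔭 h𝔭 he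
    hf f hfW ι' hι' ΩK Ωp Q hΩK hΩp hQ
  have h3Q : R1.IMCEqIntAt W p κ 𝔭bar γ Q := h3 (W.conductorNorm ℤ) K Dt H ι P hc hns rfl hK hd4 hHN
    hLt hP hcM hPinf hodd κ hκ γ 𝔭 h𝔭 he hf 𝔭bar h𝔭bar hne hsp f hfW ι' hι' ΩK Ωp Q hΩK hΩp hQ
  -- (IMC∘BDP)@`𝟙` at `(𝔭̄, embAt 𝔭̄)`, then the shadow-link road at `𝔭̄`
  have hIW := LogSymmetry.imcWaldspurgerOnTreeAt_other_of_intHalves_of_not_split_of_rankOne W p hGZK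
    hnf hPT hPT2 hEP hcd hBr hc.2.1 hc.2.2.2 hns hc.1 hK hsp hLt P hPinf κ hκ γ 𝔭 𝔭bar h𝔭 he hf h𝔭bar
    hebar hfbar Q h3Q h2Q
  exact bsdp_of_cellC_of_not_split_of_imcWaldspurgerOnTree_of_partner hnf hPT hPT2 hEP hcd hBr W p
    (W.conductorNorm ℤ) K Dt H ι P hGZ hKo hGZK hc hns rfl hK hd4 hHN hsplit hP hPinf hcM hLt Wd Cd
    hWd htw htam hu htamK κ hκ γ 𝔭bar h𝔭bar hebar hfbar hIW

/-- **Either parity, SPLIT: `BSD(E,p)` at a Heegner datum FROM Hsieh 2014 Thm. 1 + c2s♭ + c3s♭′ +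
CTL-split + the partner's rank-zero `p`-part** — `X2.bsdp_of_cellC_of_split_of_hsieh2014_of_intHalvesOnTree_of_partner`
with the IMC atom RE-ORIENTED (`h3 : X2.SplitIMCEqOnTreeIntOther W p`) and `hodd`. Proof: as the
non-split twin; CTL-split (`hCTL : X2.SplitControlOnTree W p`) is instantiated at `𝔭̄`
(`LogSymmetry.imcWaldspurgerOnTreeAt_other_of_intHalves_of_splitControl`), the shadow links
(`X11b.exists_shadowLinks_of_onTree_of_heegner`) are read at `(𝔭̄, embAt K p 𝔭̄)` and
`X2.bsdp_of_cellC_of_indexIdentityAt` concludes (as in `X2.bsdp_of_cellC_of_controlOnTreeAt_of_intHalves_of_partner`).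
CONDITIONAL on every listed binder; nothing booked. [cite: Hsieh2014, Thm. 1 (arXiv:1112.1580 pp. 3–4)]
[claim: KellerYin2024, status: under-review] [cite: Castella2018Exceptional, Thm. 2.11 (arXiv:1507.04260 p. 14) (value shape)]
[cite: Castella2018, Thm. 2.3 and §5 (5.1)–(5.3) (arXiv:1704.06608 pp. 5, 12)] [cite: Miller2011LMS, Def. 1.1] -/
theorem bsdp_of_cellC_of_split_of_hsieh2014_of_intHalvesOther_of_partner
    (hGZK : rank_eq_analyticRank_of_analyticRank_le_one) (hnf : exists_isNewformOf)
    (hH : hsieh2014_exists_anticyclotomicPAdicLFunction)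
    (N : ℕ) [NeZero N] (K : Type) [Field K] [NumberField K]
    (Dt : ModularParametrizationData W N) (H : HeegnerDatum N (NumberField.discr K)) (ι : K →+* ℂ)
    (P : (W.baseChange K).toAffine.Point)
    (hGZ : gross_zagier N W K) (hKo : kolyvagin N W K)
    (hc : CellC W p) (hs : W.HasSplitMultiplicativeReductionAtPrime p) (hN : W.conductorNorm ℤ = N)
    (hK : IsImaginaryQuadratic K) (hd4 : NumberField.discr K < -4) (hodd : Odd (NumberField.discr K))
    (hHN : SatisfiesHeegnerHypothesis N K) (hsplit : SatisfiesHeegnerHypothesis p K)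
    (hP : WeierstrassCurve.Affine.Point.map ι.toRatAlgHom P = heegnerPointComplex Dt H)
    (hPinf : ¬ IsOfFinAddOrder P) (hcM : ¬ (p : ℤ) ∣ Dt.c)
    (hLt : (W.quadraticTwist (NumberField.discr K : ℚ)).entireLFunction 1 ≠ 0)
    (Wd : WeierstrassCurve ℚ) [Wd.IsElliptic] [Wd.IsGloballyMinimal] (Cd : VariableChange ℚ)
    (hWd : Cd • W.quadraticTwist (NumberField.discr K : ℚ) = Wd) (htw : PPartRankZero Wd p)
    (htam : padicValNat p Wd.tamagawaProduct = padicValNat p W.tamagawaProduct)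
    (hu : padicValRat p (Cd.u : ℚ) = 0)
    (htamK : padicValNat p (W.baseChange K).tamagawaProduct = 2 * padicValNat p W.tamagawaProduct)
    (κ : ZpExtension K p) (hκ : κ.IsAnticyclotomic) (γ : Field.absoluteGaloisGroup K)
    [Fact (κ.IsTopGenerator γ)] (𝔭 : HeightOneSpectrum (𝓞 K))
    (h𝔭 : ((p : ℕ) : 𝓞 K) ∈ 𝔭.asIdeal) (he : 𝔭.asIdeal.ramificationIdx (𝓞 ℚ) = 1)
    (hf : 𝔭.asIdeal.inertiaDeg (𝓞 ℚ) = 1)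
    (h2 : SplitBDPValueOnTreeInt W p) (h3 : SplitIMCEqOnTreeIntOther W p) (hCTL : SplitControlOnTree W p) :
    BSDp W p := by
  subst hN
  have hp : p.Prime := Fact.out
  have hsp : SplitsIn K p := hsplit p hp dvd_rfl
  have hmod : hasEntireLFunction_rat := hasEntireLFunction_rat_of_exists_isNewformOf hnf
  obtain ⟨f, hfW⟩ := hnf W
  -- the other prime above `p`, of degree one
  obtain ⟨-, 𝔭bar, -, hne, h𝔭bar, -⟩ := LocalIndexTransport.exists_conj_prime_of_splitsIn K p hK.1 hsp h𝔭
  obtain ⟨hebar, hfbar⟩ := degreeOne_of_splitsIn hK.1 hsp h𝔭bar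
  -- an embedding datum inducing `𝔭` and Hsieh's ♭-frame there
  obtain ⟨ι₀⟩ := PadicAlgCl.nonempty_ringEquiv_complex p
  obtain ⟨ι', -, hι'⟩ := X11b.exists_datum_forall_mem_iff p ι₀ hK h𝔭
  obtain ⟨ΩK, Ωp, Q, hΩK, hΩp, hQ⟩ := exists_isBDPLFunctionInt_of_hsieh2014_of_classX2 W p hH ι' 𝔭 κ
    γ hfW hc.2 rfl hK hHN h𝔭 hι' hκ Fact.out
  -- the two ♭ atoms at `Q`
  have h2Q := h2 (W.conductorNorm ℤ) K Dt H ι P hc hs rfl hK hd4 hHN hLt hP hcM hPinf κ hκ γ 𝔭 h𝔭 he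
    hf f hfW ι' hι' ΩK Ωp Q hΩK hΩp hQ
  have h3Q : R1.IMCEqIntAt W p κ 𝔭bar γ Q := h3 (W.conductorNorm ℤ) K Dt H ι P hc hs rfl hK hd4 hHN
    hLt hP hcM hPinf hodd κ hκ γ 𝔭 h𝔭 he hf 𝔭bar h𝔭bar hne hsp f hfW ι' hι' ΩK Ωp Q hΩK hΩp hQ
  -- (IMC∘BDP)@`𝟙` and CTL at `(𝔭̄, embAt 𝔭̄)`, shadow links there, the index-identity road
  have hIW := LogSymmetry.imcWaldspurgerOnTreeAt_other_of_intHalves_of_splitControl W p hGZK hnf hc hs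
    hCTL hK hsplit hLt P hPinf κ hκ γ 𝔭 𝔭bar h𝔭 he hf h𝔭bar hebar hfbar Q h3Q h2Q
  have hCTLd : ControlOnTreeAt p κ 𝔭bar γ (embAt K p 𝔭bar h𝔭bar hebar hfbar) P :=
    hCTL K P hc hs hK hsplit hLt hPinf κ hκ γ 𝔭bar h𝔭bar hebar hfbar
  obtain ⟨S, hIMC, hBDP, hCTL', hTAM⟩ :=
    exists_shadowLinks_of_onTree_of_heegner p κ 𝔭bar γ (embAt K p 𝔭bar h𝔭bar hebar hfbar) rfl hHN hIW
      hCTLd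
  exact bsdp_of_cellC_of_indexIdentityAt W p (W.conductorNorm ℤ) K Dt H ι P hGZ hKo hGZK hmod hc hK hd4
    hHN hP hcM hLt Wd Cd hWd htw htam hu
    (fun hfin => by
      haveI := hfin
      exact indexIdentityAt_of_shadowLinks p S hIMC hBDP hCTL' hTAM htamK)

end Datum

end Summit.BirchSwinnertonDyer.BirchSwinnertonDyer.Theorems.Reoriented

end
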